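import Summits.AtomisticToContinuum.BoseEinsteinCondensation.Theses.BECStronglyRayleigh
import Summits.AtomisticToContinuum.BoseEinsteinCondensation.Theorems.InsertionFieldDelocalisation.Negative.Toolkit
import Summits.AtomisticToContinuum.BoseEinsteinCondensation.Theorems.InsertionFieldDelocalisation.Negative.LoadBearing
import Summits.AtomisticToContinuum.BoseEinsteinCondensation.Theorems.InsertionFieldDelocalisation.Negative.Tightness
import Summits.AtomisticToContinuum.BoseEinsteinCondensation.Theorems.BECStronglyRayleighSectorGroundStatePerron
import HarnessLib

/-!
# Negative lemmas for crux `InsertionFieldDelocalisation` (stmt-AtomisticToContinuum-9673), V: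
# load-bearing hypotheses of the stubs of line `mobile-trap-dirichlet-eigenfunction`

Supports (does not close) stmt-AtomisticToContinuum-9673.  The line
`Cruxes/InsertionFieldDelocalisation/Lines/mobile_trap_dirichlet_eigenfunction.lean` (lead's def-free
reshape) proves the crux from six stubs; its hardest stub `stub_annealedGain` concludes
`AnnealedGain'`: conditionally on the void radius `ρ_T(x) = R` the size-biased mean of the normalised
two-particle insertion profile `L³ q_T(x) = L³ r^T_x / Σ_y r^T_y` is at most `C₂ e^{c₂ (N/L³) R²}`.
Here we record, as kernel-checked witnesses, which hypotheses of that conclusion are load-bearing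
(drefute seat; nothing in this file asserts a Theses statement or a stub positively):

* `annealedGain_false_without_groundState` — delete `Hψ = E_min ψ` (keep sector, `ψ ≠ 0`,
  nonnegativity): FALSE.  Witness `N = 2`, the frozen pair `ψ = δ_{1_{{a,b}}}`: `T = ∅`, void radius
  `0` everywhere, `r^∅ = 1_{{a,b}}`, so the `R = 0` shell reads `L³ ≤ 2 C₂`.
* `annealedGain_false_without_halfFilling` — delete `2N ≤ L³`: FALSE.  Witness `N = L³`,
  `ψ = |↑…↑⟩` (an eigenvector with `H|↑…↑⟩ = 0 = E_min`, landed `lowestEnergyInSector_allUp`): every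
  two-hole field is `1_{Tᶜ}` on two sites, each at void radius `1`, so the `R = 1` shell reads
  `L³/2 ≤ C₂ e^{c₂}`.

* companion file `MobileTrapVoidTail.lean`: `voidTail_false_without_groundState` — the second XL stub
  `stub_voidTail` also needs the eigen-equation (far-slab cluster witness, torus distance toolkit).

So any proof of `stub_annealedGain` must use both the eigen-equation and the filling restriction —
exactly the two load-bearing hypotheses of the crux itself (`LoadBearing.lean`), now localised in the
line's hardest stub (the line card asserts this; here it is checked).  Toolkit by-product for the
provers of `stub_voidTail` / `stub_annealedGain` / `stub_transfer`: `voidRadius_empty`,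
`voidRadius_eq_one` (the `R = 0` and `R = 1` shells).
-/

noncomputable section

namespace Summit.AtomisticToContinuum.BoseEinsteinCondensation.Theorems.InsertionFieldDelocalisation.Negative

open scoped BigOperators ComplexOrder
open Literature.MathematicalPhysics.QuantumLattice Literature.Probability.LatticeModels Matrix Finset
open Summit.AtomisticToContinuum.BoseEinsteinCondensation.Theses.BECStronglyRayleigh
open Summit.AtomisticToContinuum.BoseEinsteinCondensation.Theorems.BECStronglyRayleighSectorPerron
  (torusGraph_connected)

/-! ### The void radius of the line (graph distance to the nearest particle of `T`, `0` if `T = ∅`)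

The stubs `stub_voidTail`, `stub_annealedGain`, `stub_transfer` use the expression
`ρ_T(x) = ((T.image fun t => (torusGraph 3 L).dist x t).min.untopD 0)` verbatim; we keep it raw. -/

/-- The void radius of the empty configuration is `0` (the `untopD` default). [folklore] -/
theorem voidRadius_empty {L : ℕ} (x : TorusSite 3 L) :
    (((∅ : Finset (TorusSite 3 L)).image fun t => (torusGraph 3 L).dist x t).min.untopD 0) = 0 := by
  rw [Finset.image_empty, Finset.min_empty, WithTop.untopD_top]

/-- If some `t₀ ∈ T` is adjacent to `x` and `x ∉ T`, the void radius is `1`. [folklore] -/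
theorem voidRadius_eq_one {L : ℕ} {T : Finset (TorusSite 3 L)} {x t₀ : TorusSite 3 L}
    (ht₀ : t₀ ∈ T) (hadj : (torusGraph 3 L).Adj x t₀) (hx : x ∉ T) :
    ((T.image fun t => (torusGraph 3 L).dist x t).min.untopD 0) = 1 := by
  have hmin : (T.image fun t => (torusGraph 3 L).dist x t).min = ((1 : ℕ) : WithTop ℕ) := by
    apply le_antisymm
    · refine Finset.min_le (Finset.mem_image.mpr ⟨t₀, ht₀, ?_⟩)
      exact SimpleGraph.dist_eq_one_iff_adj.mpr hadj
    · refine Finset.le_min fun b hb => ?_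
      obtain ⟨t, ht, rfl⟩ := Finset.mem_image.mp hb
      have hne : x ≠ t := fun h => hx (h ▸ ht)
      exact WithTop.coe_le_coe.mpr ((torusGraph_connected 3 L).pos_dist_of_ne hne)
  rw [hmin]
  rfl

/-! ### `AnnealedGain'` without the eigen-equation -/

/-- Sums of the two shell functionals on a `{0,1}`-valued field supported on two sites. [folklore] -/
theorem sum_indicator_gain {Λ : Type*} [Fintype Λ] (p : Λ → Prop) [DecidablePred p] (V : ℝ)
    (hp : (Finset.univ.filter p).card = 2) :
    (∑ x, (if p x then (1 : ℝ) else 0) ^ 2 *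
        (V * (if p x then (1 : ℝ) else 0) / ∑ y, (if p y then (1 : ℝ) else 0))) = V := by
  have hsum : (∑ y, (if p y then (1 : ℝ) else 0)) = 2 := by
    rw [Finset.sum_boole, hp]; norm_num
  rw [hsum]
  have h : ∀ x, (if p x then (1 : ℝ) else 0) ^ 2 * (V * (if p x then (1 : ℝ) else 0) / 2) =
      if p x then V / 2 else 0 := by
    intro x; split_ifs <;> ring
  simp_rw [h]
  rw [Finset.sum_ite, Finset.sum_const_zero, add_zero, Finset.sum_const, hp, nsmul_eq_mul]
  push_cast
  ring

/-- **Any proof of `stub_annealedGain` must use the eigen-equation.** Witness: `N = 2`, the frozen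
pair `δ_{1_{{a,b}}}`; `T = ∅` has void radius `0` at every site and field `1_{{a,b}}`, so the
`R = 0` shell inequality is `L³ ≤ C₂ · e⁰ · 2`, false for `L³ > 2C₂`. [folklore] -/
theorem annealedGain_false_without_groundState : ¬
    (∃ C₂ c₂ : ℝ, ∀ (L : ℕ) [NeZero L], 2 ≤ L → ∀ N : ℕ, 2 ≤ N → 2 * N ≤ L ^ 3 →
      ∀ ψ : TensorIndex (TorusSite 3 L) 2 → ℂ,
        ψ ∈ spinZSector 1 ((N : ℝ) - (L : ℝ) ^ 3 / 2) → ψ ≠ 0 →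
        (∀ σ, 0 ≤ (ψ σ).re ∧ (ψ σ).im = 0) → ∀ R : ℕ,
        (∑ T ∈ (Finset.univ : Finset (TorusSite 3 L)).powersetCard (N - 2), ∑ x : TorusSite 3 L,
            if ((T.image fun t => (torusGraph 3 L).dist x t).min.untopD 0) = R then
              field ψ T x ^ 2 * ((L : ℝ) ^ 3 * field ψ T x / ∑ y : TorusSite 3 L, field ψ T y)
            else 0)
          ≤ C₂ * Real.exp (c₂ * ((N : ℝ) / (L : ℝ) ^ 3) * (R : ℝ) ^ 2) *
            ∑ T ∈ (Finset.univ : Finset (TorusSite 3 L)).powersetCard (N - 2), ∑ x : TorusSite 3 L,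
              if ((T.image fun t => (torusGraph 3 L).dist x t).min.untopD 0) = R then
                field ψ T x ^ 2 else 0) := by
  rintro ⟨C₂, c₂, h⟩
  obtain ⟨L, hL2, hLM⟩ := exists_side_gt (2 * C₂)
  haveI : NeZero L := ⟨by omega⟩
  obtain ⟨a, b, hab⟩ := exists_pair_torusSite L hL2
  have hNL : 2 * 2 ≤ L ^ 3 :=
    calc 2 * 2 ≤ 2 ^ 3 := by norm_num
      _ ≤ L ^ 3 := Nat.pow_le_pow_left hL2 3
  have hsec : bvec (fun z => if z ∈ ({a, b} : Finset (TorusSite 3 L)) then (0 : Fin 2) else 1) ∈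
      spinZSector 1 (((2 : ℕ) : ℝ) - (L : ℝ) ^ 3 / 2) := by
    refine bvec_ind_mem_spinZSector _ _ ?_
    rw [Finset.card_pair hab, card_torusSite 3 L]
    push_cast
    ring
  have key := h L hL2 2 le_rfl hNL _ hsec (bvec_ne_zero _) (bvec_nonneg _) 0
  have hcard : (Finset.univ.filter fun x : TorusSite 3 L => x = a ∨ x = b).card = 2 := by
    have hf : (Finset.univ.filter fun x : TorusSite 3 L => x = a ∨ x = b) = {a, b} := by
      ext x; simp
    rw [hf, Finset.card_pair hab]
  rw [show 2 - 2 = 0 from rfl, Finset.powersetCard_zero, Finset.sum_singleton,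
    Finset.sum_singleton] at key
  simp only [Finset.image_empty, Finset.min_empty, WithTop.untopD_top, if_true, Nat.cast_zero,
    Nat.cast_ofNat] at key
  rw [field_pairState hab, sum_indicator_gain _ _ hcard] at key
  have hrhs : (∑ x : TorusSite 3 L, (if x = a ∨ x = b then (1 : ℝ) else 0) ^ 2) = 2 := by
    have := K1rhs_boolIndicator (Λ := TorusSite 3 L) (fun x => x = a ∨ x = b)
    rw [K1rhs] at this
    rw [this, hcard]; norm_num
  rw [hrhs] at key
  have hexp : Real.exp (c₂ * ((2 : ℝ) / (L : ℝ) ^ 3) * (0 : ℝ) ^ 2) = 1 := by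
    rw [sq, mul_zero, mul_zero, Real.exp_zero]
  rw [hexp] at key
  linarith

/-! ### `AnnealedGain'` without the filling restriction -/

/-- Two distinct neighbours `e₀, e₁` of the origin of `(ℤ/Lℤ)³`, `L ≥ 2`. [folklore] -/
theorem origin_neighbours (L : ℕ) (hL : 2 ≤ L) :
    (torusGraph 3 L).Adj (0 : TorusSite 3 L) (Pi.single 0 1) ∧
      (Pi.single (0 : Fin 3) (1 : ZMod L) : TorusSite 3 L) ≠ Pi.single 1 1 ∧
      (Pi.single (0 : Fin 3) (1 : ZMod L) : TorusSite 3 L) ≠ 0 ∧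
      (Pi.single (1 : Fin 3) (1 : ZMod L) : TorusSite 3 L) ≠ 0 := by
  haveI : Fact (1 < L) := ⟨hL⟩
  have h1 : (1 : ZMod L) ≠ 0 := one_ne_zero
  have hne0 : (Pi.single (0 : Fin 3) (1 : ZMod L) : TorusSite 3 L) ≠ 0 := by
    intro h
    have := congrFun h 0
    simp at this
  have hne1 : (Pi.single (1 : Fin 3) (1 : ZMod L) : TorusSite 3 L) ≠ 0 := by
    intro h
    have := congrFun h 1
    simp at this
  have hne01 : (Pi.single (0 : Fin 3) (1 : ZMod L) : TorusSite 3 L) ≠ Pi.single 1 1 := by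
    intro h
    have := congrFun h 0
    simp at this
  refine ⟨?_, hne01, hne0, hne1⟩
  rw [torusGraph_adj_iff]
  exact ⟨hne0.symm, Or.inl ⟨0, by rw [zero_add]⟩⟩

/-- **Any proof of `stub_annealedGain` must use `2N ≤ L³`.** Witness: `N = L³`, `ψ = |↑…↑⟩`
(`H|↑…↑⟩ = 0 = E_min` in the saturated sector); at every `(L³-2)`-set `T` the two-hole field is
`1_{Tᶜ}`, so on the `R = 1` shell the left side is `(L³/2)·S` and the right side `C₂e^{c₂}·S` with
`S ≥ 1` the number of pairs `(T, x)`, `x ∉ T`, at void radius `1` (e.g. `T = Λ ∖ {0, e₁}`, `x = 0`,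
whose neighbour `e₀` lies in `T`): `L³ ≤ 2C₂e^{c₂}` fails for large `L`. [folklore] -/
theorem annealedGain_false_without_halfFilling : ¬
    (∃ C₂ c₂ : ℝ, ∀ (L : ℕ) [NeZero L], 2 ≤ L → ∀ N : ℕ, 2 ≤ N →
      ∀ ψ : TensorIndex (TorusSite 3 L) 2 → ℂ,
        ψ ∈ spinZSector 1 ((N : ℝ) - (L : ℝ) ^ 3 / 2) → ψ ≠ 0 →
        (xyTorus 3 L 1).mulVec ψ =
          ((lowestEnergyInSector 1 (xyTorus 3 L 1) ((N : ℝ) - (L : ℝ) ^ 3 / 2) : ℝ) : ℂ) • ψ →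
        (∀ σ, 0 ≤ (ψ σ).re ∧ (ψ σ).im = 0) → ∀ R : ℕ,
        (∑ T ∈ (Finset.univ : Finset (TorusSite 3 L)).powersetCard (N - 2), ∑ x : TorusSite 3 L,
            if ((T.image fun t => (torusGraph 3 L).dist x t).min.untopD 0) = R then
              field ψ T x ^ 2 * ((L : ℝ) ^ 3 * field ψ T x / ∑ y : TorusSite 3 L, field ψ T y)
            else 0)
          ≤ C₂ * Real.exp (c₂ * ((N : ℝ) / (L : ℝ) ^ 3) * (R : ℝ) ^ 2) *
            ∑ T ∈ (Finset.univ : Finset (TorusSite 3 L)).powersetCard (N - 2), ∑ x : TorusSite 3 L,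
              if ((T.image fun t => (torusGraph 3 L).dist x t).min.untopD 0) = R then
                field ψ T x ^ 2 else 0) := by
  rintro ⟨C₂, c₂, h⟩
  obtain ⟨L, hL2, hLM⟩ := exists_side_gt (2 * C₂ * Real.exp c₂)
  haveI : NeZero L := ⟨by omega⟩
  have hL3 : 2 ≤ L ^ 3 :=
    calc 2 ≤ 2 ^ 3 := by norm_num
      _ ≤ L ^ 3 := Nat.pow_le_pow_left hL2 3
  set σ₀ : TensorIndex (TorusSite 3 L) 2 :=
    fun z => if z ∈ (Finset.univ : Finset (TorusSite 3 L)) then (0 : Fin 2) else 1 with hσ₀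
  have hσ₀' : σ₀ = fun _ => 0 := by
    funext z
    simp [hσ₀]
  have hsec : bvec σ₀ ∈ spinZSector 1 (((L ^ 3 : ℕ) : ℝ) - (L : ℝ) ^ 3 / 2) := by
    refine bvec_ind_mem_spinZSector _ _ ?_
    rw [Finset.card_univ, card_torusSite 3 L]
    push_cast
    ring
  have hE : lowestEnergyInSector 1 (xyTorus 3 L 1) (((L ^ 3 : ℕ) : ℝ) - (L : ℝ) ^ 3 / 2) = 0 := by
    refine lowestEnergyInSector_allUp _ _ _ ?_
    rw [card_torusSite 3 L]
    push_cast
    ring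
  have heig : (xyTorus 3 L 1).mulVec (bvec σ₀) =
      ((lowestEnergyInSector 1 (xyTorus 3 L 1) (((L ^ 3 : ℕ) : ℝ) - (L : ℝ) ^ 3 / 2) : ℝ) : ℂ) •
        bvec σ₀ := by
    rw [hE, Complex.ofReal_zero, zero_smul, mulVec_bvec, hσ₀']
    funext σ
    exact xxz_apply_allUp _ _ σ
  have key := h L hL2 (L ^ 3) hL3 (bvec σ₀) hsec (bvec_ne_zero _) heig (bvec_nonneg _) 1
  -- the cardinality bookkeeping on `(L³ - 2)`-sets
  have hTcard : ∀ T ∈ (Finset.univ : Finset (TorusSite 3 L)).powersetCard (L ^ 3 - 2),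
      T.card + 2 = Fintype.card (TorusSite 3 L) := by
    intro T hT
    rw [(Finset.mem_powersetCard.mp hT).2, card_torusSite 3 L]
    omega
  -- the shell indicator, abbreviated
  set S : ℝ := ∑ T ∈ (Finset.univ : Finset (TorusSite 3 L)).powersetCard (L ^ 3 - 2),
      ∑ x : TorusSite 3 L, (if ((T.image fun t => (torusGraph 3 L).dist x t).min.untopD 0) = 1 then (if x ∉ T then (1 : ℝ) else 0) else 0)
    with hS
  -- left side = (L³/2)·S
  have hlhs : (∑ T ∈ (Finset.univ : Finset (TorusSite 3 L)).powersetCard (L ^ 3 - 2),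
      ∑ x : TorusSite 3 L,
        (if ((T.image fun t => (torusGraph 3 L).dist x t).min.untopD 0) = 1 then
          field (bvec σ₀) T x ^ 2 *
            ((L : ℝ) ^ 3 * field (bvec σ₀) T x / ∑ y : TorusSite 3 L, field (bvec σ₀) T y)
        else 0)) = (L : ℝ) ^ 3 / 2 * S := by
    rw [hS, Finset.mul_sum]
    refine Finset.sum_congr rfl fun T hT => ?_
    rw [Finset.mul_sum]
    refine Finset.sum_congr rfl fun x _ => ?_
    have hf := field_fullState T (hTcard T hT)
    rw [hσ₀, hf]
    have hsum : (∑ y : TorusSite 3 L, (if y ∉ T then (1 : ℝ) else 0)) = 2 := by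
      rw [Finset.sum_boole, card_filter_notMem T (hTcard T hT)]; norm_num
    rw [hsum]
    change (if ((T.image fun t => (torusGraph 3 L).dist x t).min.untopD 0) = 1 then _ else _) = _
    by_cases hρ : ((T.image fun t => (torusGraph 3 L).dist x t).min.untopD 0) = 1
    · by_cases hx : x ∈ T
      · simp [hρ, hx]
      · simp [hρ, hx]
    · simp [hρ]
  -- right side sum = S
  have hrhs : (∑ T ∈ (Finset.univ : Finset (TorusSite 3 L)).powersetCard (L ^ 3 - 2),
      ∑ x : TorusSite 3 L,
        (if ((T.image fun t => (torusGraph 3 L).dist x t).min.untopD 0) = 1 then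
          field (bvec σ₀) T x ^ 2 else 0)) = S := by
    rw [hS]
    refine Finset.sum_congr rfl fun T hT => Finset.sum_congr rfl fun x _ => ?_
    have hf := field_fullState T (hTcard T hT)
    rw [hσ₀, hf]
    change (if ((T.image fun t => (torusGraph 3 L).dist x t).min.untopD 0) = 1 then _ else _) = _
    by_cases hρ : ((T.image fun t => (torusGraph 3 L).dist x t).min.untopD 0) = 1
    · by_cases hx : x ∈ T
      · simp [hρ, hx]
      · simp [hρ, hx]
    · simp [hρ]
  rw [hlhs, hrhs] at key
  -- S ≥ 1: the pair (T₀, 0) with T₀ = Λ \ {0, e₁}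
  obtain ⟨hadj, hne01, hne0, hne1⟩ := origin_neighbours L hL2
  set T₀ : Finset (TorusSite 3 L) := Finset.univ \ {0, Pi.single 1 1} with hT₀
  have hT₀mem : T₀ ∈ (Finset.univ : Finset (TorusSite 3 L)).powersetCard (L ^ 3 - 2) := by
    rw [Finset.mem_powersetCard]
    refine ⟨Finset.subset_univ _, ?_⟩
    rw [hT₀, Finset.card_sdiff, Finset.inter_univ, Finset.card_univ, card_torusSite 3 L,
      Finset.card_pair hne1.symm]
  have h0T₀ : (0 : TorusSite 3 L) ∉ T₀ := by
    rw [hT₀]; simp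
  have he₀T₀ : (Pi.single (0 : Fin 3) (1 : ZMod L) : TorusSite 3 L) ∈ T₀ := by
    rw [hT₀]
    simp only [Finset.mem_sdiff, Finset.mem_univ, Finset.mem_insert, Finset.mem_singleton,
      true_and, not_or]
    exact ⟨hne0, hne01⟩
  have hρ : ((T₀.image fun t => (torusGraph 3 L).dist 0 t).min.untopD 0) = 1 := voidRadius_eq_one he₀T₀ hadj h0T₀
  have hS1 : 1 ≤ S := by
    set f : Finset (TorusSite 3 L) → TorusSite 3 L → ℝ := fun T x =>
      if ((T.image fun t => (torusGraph 3 L).dist x t).min.untopD 0) = 1 then (if x ∉ T then (1 : ℝ) else 0) else 0 with hfdef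
    have hf0 : ∀ T x, 0 ≤ f T x := by
      intro T x
      simp only [hfdef]
      split_ifs <;> norm_num
    have hterm : f T₀ 0 = 1 := by
      simp only [hfdef]
      rw [if_pos hρ, if_pos h0T₀]
    have h1 : f T₀ 0 ≤ ∑ x : TorusSite 3 L, f T₀ x :=
      Finset.single_le_sum (f := fun x => f T₀ x) (fun x _ => hf0 T₀ x) (Finset.mem_univ _)
    have h2 : (∑ x : TorusSite 3 L, f T₀ x) ≤
        ∑ T ∈ (Finset.univ : Finset (TorusSite 3 L)).powersetCard (L ^ 3 - 2),
          ∑ x : TorusSite 3 L, f T x :=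
      Finset.single_le_sum (f := fun T => ∑ x : TorusSite 3 L, f T x)
        (fun T _ => Finset.sum_nonneg fun x _ => hf0 T x) hT₀mem
    have hS' : S = ∑ T ∈ (Finset.univ : Finset (TorusSite 3 L)).powersetCard (L ^ 3 - 2),
        ∑ x : TorusSite 3 L, f T x := by rw [hS]
    rw [hS']
    linarith
  have hexp : Real.exp (c₂ * ((((L ^ 3 : ℕ) : ℝ)) / (L : ℝ) ^ 3) * ((1 : ℕ) : ℝ) ^ 2) =
      Real.exp c₂ := by
    have hL0 : (L : ℝ) ^ 3 ≠ 0 := by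
      have : (0 : ℝ) < L := by exact_mod_cast (show 0 < L by omega)
      positivity
    push_cast
    rw [div_self hL0]
    simp
  rw [hexp] at key
  -- key : L³/2 · S ≤ C₂ e^{c₂} S, with S ≥ 1 and L³ > 2 C₂ e^{c₂}
  have hpos : 0 < Real.exp c₂ := Real.exp_pos _
  have hS0 : 0 < S := by linarith
  have key' : (L : ℝ) ^ 3 / 2 ≤ C₂ * Real.exp c₂ := le_of_mul_le_mul_right (by linarith) hS0
  linarith

end Summit.AtomisticToContinuum.BoseEinsteinCondensation.Theorems.InsertionFieldDelocalisation.Negative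

end
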